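import Literature.NumberTheory.Rogawski1990.ArchCentralLimitCornerRegularityOfJetBounds    -- ★ p846672 (F0P3a-p09 (g2)): `archCentralLimitFormulaRankTwo_of_liePhiJetBounds`, `archCentralLimitExists_of_liePhiJetBounds`, `archCentralLimitCornerRegularity_of_liePhiJetBounds`
import Literature.Geometry.ComplexHyperbolic.UnitBallLieAlgebraChamberJets                  -- ★ p846680 ((d2) FILE 3b, ROAD A owner F0P3a-p05 (g15)): `liePhi_chamberJetBounds` — the `hball` packager
import Literature.NumberTheory.Rogawski1990.ArchCentralValueTransferExistsClosedOfLetter   -- ★ p842682 (F0P3a-p03 (g11)): `archCentralValueTransferExistsClosed_of_letter` — (S-d) from the letter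
import HarnessLib

/-!
# THE ARCHIMEDEAN LETTERS HOLD — `ArchCentralLimitFormulaRankTwo`, `ArchCentralLimitExists` and `ArchCentralValueTransferExistsClosed` are THEOREMS of the tree, with NO hypothesis
# (Harish-Chandra's limit formula at the centre of the compact Cartan of `U(2,1)`, Rogawski 1990 §8.4 pp. 126–127; the central-value transfer (S-d), §14.5 p. 239)

Topic `NumberTheory/Rogawski1990`; namespace `Literature.NumberTheory.Rogawski1990`.  THEOREMS ONLY (no `def`, no instance, no notation, no axiom, no named fact, no `sorry`).
Cell `pub/hodgecm-mathlib`, ENGINE T1 (crux H413 = `stmt-HodgeConjecture-24833`), F0P3a-p09 (g3), 2026-09-01.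

THE POINT.  Three Literature `def … : Prop` named facts of this topic — the (L_{U(2,1)}) LETTER ★ def `ArchCentralLimitFormulaRankTwo` (p842205: `∃ c > 0, ∀ Θ ζ, Tendsto Λ₈[ρ′Δ·Φ_Θ]
(𝓝[T_reg] ζ•1) (𝓝 (−c·i·Θ(ζ•1)))`), its continuity half (A6-lim) ★ def `ArchCentralLimitExists` (p846449) and the closed (S-d) row ★ def `ArchCentralValueTransferExistsClosed` — were until
tonight discharged only INSIDE the crux workfiles (`Cruxes/H413/Lines/F0_U3LettersRung1KitRung0` ED. 3 `Kit.a6lim_of_jets`, closer ED. 36 `stub_A6lim`∕`stub_L21`∕`stub_Sd`, mirror `F0_P3a_SdArch`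
ED. 6).  This file states them as hypothesis-free Literature theorems, by composing two ★ Literature files: ★ `archCentralLimitFormulaRankTwo_of_liePhiJetBounds (hball)` (p846672: (A6) corner
regularity at the e-pattern frames by ★ Whitney-convex + ★ the closure lemma, then the letter at every frame over the ★ W6-core value `ballCore_of_rayIdentity rayIdentity_of_total` and ★
`wall02_cubeLimit`) with `hball := liePhi_chamberJetBounds` (★ p846680: Harish-Chandra's chamber jet bounds for `liePhi μ f`, ROAD «A6-IV» (d2)).  So in Literature, by name:
* `ArchCentralLimitFormulaRankTwo_holds : ∀ L [Field L] α w, ArchCentralLimitFormulaRankTwo L α w` — THE LETTER (L_{U(2,1)});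
* `ArchCentralLimitExists_holds : ∀ L [Field L] α w, ArchCentralLimitExists L α w` — (A6-lim);
* `archCentralLimitCornerRegularity_of_signs (h0 h1 h2) : ArchCentralLimitCornerRegularity L α w` — (A6) at every e-pattern frame `re σ_wα₀, re σ_wα₁ > 0 > re σ_wα₂` (the other sign
  patterns are not derived here: the ★ transport `archCentralLimitFormulaRankTwo_of_ppm` moves the LETTER across frames, not the corner extensions);
* `ArchCentralValueTransferExistsClosed_holds : ArchCentralValueTransferExistsClosed` — (S-d) CLOSED (= the closer's `stub_Sd` text BY NAME), by ★ p842682 over the letter.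
HONEST LABEL: HC_CM is proved only modulo the printed citations until rung 0 closes; this file is plumbing over ★ bricks (books #179 «(A6-lim)» and #180 «W6-core» are already CLOSED ★
IN-HOUSE at closer ED. 36 ∕ SdArch ED. 5–6); it moves no registry row and adds no print input — it only makes the three named facts citable as theorems from `Literature.*`.

## References
* [Rogawski1990] J. D. Rogawski, *Automorphic Representations of Unitary Groups in Three Variables*, Ann. of Math. Stud. 123 (1990), §8.4 pp. 126–127; §14.5 p. 239.
* [HarishChandra1975HARRG1] Harish-Chandra, *Harmonic analysis on real reductive groups I*, J. Funct. Anal. 19 (1975), §17 Lemma 17.5.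
* [WarnerHASSLG2] G. Warner, *Harmonic Analysis on Semi-Simple Lie Groups II*, Grundlehren 189 (1972), Thm. 8.4.3.1; §8.5.1 Thm. 8.5.1.1.
-/

set_option autoImplicit false

noncomputable section

open NumberField NumberField.InfinitePlace

namespace Literature.NumberTheory.Rogawski1990

open Literature.Geometry.ComplexHyperbolic.BallModel (liePhi_chamberJetBounds)

/-- **THE (L_{U(2,1)}) LETTER HOLDS**: Harish-Chandra's limit formula at the centre of the compact Cartan of `G_w = U(σ_w diag α)(ℂ)`, ★ def `ArchCentralLimitFormulaRankTwo L α w`, at EVERY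
field `L`, diagonal frame `α` and complex place `w`, with no hypothesis — ★ p846672 fed with ★ p846680. [cite: Rogawski1990, §8.4 pp. 126–127] [cite: HarishChandra1975HARRG1, §17 Lemma 17.5]
[cite: WarnerHASSLG2, Thm. 8.4.3.1; §8.5.1 Thm. 8.5.1.1] -/
theorem ArchCentralLimitFormulaRankTwo_holds :
    ∀ (L : Type) [Field L] (α : Fin 3 → L) (w : {w : InfinitePlace L // IsComplex w}), ArchCentralLimitFormulaRankTwo L α w :=
  archCentralLimitFormulaRankTwo_of_liePhiJetBounds liePhi_chamberJetBounds

/-- **(A6-lim) HOLDS**: the central limit of `ω(ρ′Δ·Φ_Θ)` EXISTS at the centre, ★ def `ArchCentralLimitExists L α w` (Rogawski p. 126 L13, continuity half), at every frame, with no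
hypothesis (= the closer's row `stub_A6lim` ∕ the kit term `Kit.a6lim_of_jets`, now citable from Literature). [cite: Rogawski1990, §8.4 p. 126 L13] [cite: HarishChandra1975HARRG1, §17 Lemma 17.5] -/
theorem ArchCentralLimitExists_holds :
    ∀ (L : Type) [Field L] (α : Fin 3 → L) (w : {w : InfinitePlace L // IsComplex w}), ArchCentralLimitExists L α w :=
  archCentralLimitExists_of_liePhiJetBounds liePhi_chamberJetBounds

/-- **(A6) AT THE e-PATTERN FRAMES**: Harish-Chandra's corner regularity ★ def `ArchCentralLimitCornerRegularity L α w` (a `C³` extension of `ρ′Δ·Φ_Θ∘chart_ζ` across the corner on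
each of the six chambers) at every frame with `re σ_wα₀ > 0`, `re σ_wα₁ > 0`, `re σ_wα₂ < 0`, with no further hypothesis (★ p846672 §1 fed with ★ p846680).
[cite: HarishChandra1975HARRG1, §17 Lemma 17.5] [cite: WarnerHASSLG2, Thm. 8.4.3.1; §8.5.1 Thm. 8.5.1.1] [cite: Rogawski1990, §8.4 p. 126] -/
theorem archCentralLimitCornerRegularity_of_signs (L : Type) [Field L] (α : Fin 3 → L) (w : {w : InfinitePlace L // IsComplex w})
    (h0 : 0 < (w.1.embedding (α 0)).re) (h1 : 0 < (w.1.embedding (α 1)).re) (h2 : (w.1.embedding (α 2)).re < 0) :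
    ArchCentralLimitCornerRegularity L α w :=
  archCentralLimitCornerRegularity_of_liePhiJetBounds L α w h0 h1 h2 liePhi_chamberJetBounds

/-- **(S-d) CLOSED, UNCONDITIONALLY**: ★ def `ArchCentralValueTransferExistsClosed` (the closer's `stub_Sd` text BY NAME: for every CM field `L`, hermitian datum `H′`, factor `T`
and Haar data, the archimedean central-value transfer letter `ArchCentralValueTransferExists L H′ T ν′ νH`) — by ★ p842682 `archCentralValueTransferExistsClosed_of_letter` over the letter above.
[cite: Rogawski1990, §14.5 p. 239; §8.4 pp. 126–127; §1.7 p. 6] -/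
theorem ArchCentralValueTransferExistsClosed_holds : ArchCentralValueTransferExistsClosed :=
  archCentralValueTransferExistsClosed_of_letter ArchCentralLimitFormulaRankTwo_holds

end Literature.NumberTheory.Rogawski1990

end
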